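import Literature.NumberTheory.LFunctions.WeilFirstPrimeCertificateDataA
import HarnessLib

/-!
# First-prime Weil positivity on `C(2/5)`: kernel check of the moments, part `1/2`

Sibling of `WeilFirstPrimeCertificateDataA.lean`: the claimed moments `ν_q` (`weilCert2ANu`) agree
with `WeilCert2.nuQ` (`= a₀^q · 2 Σ_cells ∫ (wL − σ) s^q`, exact rational integration of the cell
polynomials) at the even `q = 0 … 58` — one kernel evaluation per moment (`checkNuAt`), since a
single evaluation of the whole table exhausts the kernel's memory (and so does parallel elaboration, whence
`Elab.async false`).
-/

set_option Elab.async false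

noncomputable section

namespace Literature.NumberTheory.LFunctions

/-- Moment `ν_{0}`. [folklore] -/
theorem weilCert2A_nu_0 : weilCert2A.checkNuAt 0 = true := by
  decide +kernel

/-- Moment `ν_{2}`. [folklore] -/
theorem weilCert2A_nu_1 : weilCert2A.checkNuAt 2 = true := by
  decide +kernel

/-- Moment `ν_{4}`. [folklore] -/
theorem weilCert2A_nu_2 : weilCert2A.checkNuAt 4 = true := by
  decide +kernel

/-- Moment `ν_{6}`. [folklore] -/
theorem weilCert2A_nu_3 : weilCert2A.checkNuAt 6 = true := by
  decide +kernel

/-- Moment `ν_{8}`. [folklore] -/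
theorem weilCert2A_nu_4 : weilCert2A.checkNuAt 8 = true := by
  decide +kernel

/-- Moment `ν_{10}`. [folklore] -/
theorem weilCert2A_nu_5 : weilCert2A.checkNuAt 10 = true := by
  decide +kernel

/-- Moment `ν_{12}`. [folklore] -/
theorem weilCert2A_nu_6 : weilCert2A.checkNuAt 12 = true := by
  decide +kernel

/-- Moment `ν_{14}`. [folklore] -/
theorem weilCert2A_nu_7 : weilCert2A.checkNuAt 14 = true := by
  decide +kernel

/-- Moment `ν_{16}`. [folklore] -/
theorem weilCert2A_nu_8 : weilCert2A.checkNuAt 16 = true := by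
  decide +kernel

/-- Moment `ν_{18}`. [folklore] -/
theorem weilCert2A_nu_9 : weilCert2A.checkNuAt 18 = true := by
  decide +kernel

/-- Moment `ν_{20}`. [folklore] -/
theorem weilCert2A_nu_10 : weilCert2A.checkNuAt 20 = true := by
  decide +kernel

/-- Moment `ν_{22}`. [folklore] -/
theorem weilCert2A_nu_11 : weilCert2A.checkNuAt 22 = true := by
  decide +kernel

/-- Moment `ν_{24}`. [folklore] -/
theorem weilCert2A_nu_12 : weilCert2A.checkNuAt 24 = true := by
  decide +kernel

/-- Moment `ν_{26}`. [folklore] -/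
theorem weilCert2A_nu_13 : weilCert2A.checkNuAt 26 = true := by
  decide +kernel

/-- Moment `ν_{28}`. [folklore] -/
theorem weilCert2A_nu_14 : weilCert2A.checkNuAt 28 = true := by
  decide +kernel

/-- Moment `ν_{30}`. [folklore] -/
theorem weilCert2A_nu_15 : weilCert2A.checkNuAt 30 = true := by
  decide +kernel

/-- Moment `ν_{32}`. [folklore] -/
theorem weilCert2A_nu_16 : weilCert2A.checkNuAt 32 = true := by
  decide +kernel

/-- Moment `ν_{34}`. [folklore] -/
theorem weilCert2A_nu_17 : weilCert2A.checkNuAt 34 = true := by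
  decide +kernel

/-- Moment `ν_{36}`. [folklore] -/
theorem weilCert2A_nu_18 : weilCert2A.checkNuAt 36 = true := by
  decide +kernel

/-- Moment `ν_{38}`. [folklore] -/
theorem weilCert2A_nu_19 : weilCert2A.checkNuAt 38 = true := by
  decide +kernel

/-- Moment `ν_{40}`. [folklore] -/
theorem weilCert2A_nu_20 : weilCert2A.checkNuAt 40 = true := by
  decide +kernel

/-- Moment `ν_{42}`. [folklore] -/
theorem weilCert2A_nu_21 : weilCert2A.checkNuAt 42 = true := by
  decide +kernel

/-- Moment `ν_{44}`. [folklore] -/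
theorem weilCert2A_nu_22 : weilCert2A.checkNuAt 44 = true := by
  decide +kernel

/-- Moment `ν_{46}`. [folklore] -/
theorem weilCert2A_nu_23 : weilCert2A.checkNuAt 46 = true := by
  decide +kernel

/-- Moment `ν_{48}`. [folklore] -/
theorem weilCert2A_nu_24 : weilCert2A.checkNuAt 48 = true := by
  decide +kernel

/-- Moment `ν_{50}`. [folklore] -/
theorem weilCert2A_nu_25 : weilCert2A.checkNuAt 50 = true := by
  decide +kernel

/-- Moment `ν_{52}`. [folklore] -/
theorem weilCert2A_nu_26 : weilCert2A.checkNuAt 52 = true := by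
  decide +kernel

/-- Moment `ν_{54}`. [folklore] -/
theorem weilCert2A_nu_27 : weilCert2A.checkNuAt 54 = true := by
  decide +kernel

/-- Moment `ν_{56}`. [folklore] -/
theorem weilCert2A_nu_28 : weilCert2A.checkNuAt 56 = true := by
  decide +kernel

/-- Moment `ν_{58}`. [folklore] -/
theorem weilCert2A_nu_29 : weilCert2A.checkNuAt 58 = true := by
  decide +kernel

end Literature.NumberTheory.LFunctions
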